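import Summits.Ventures.LatticeQCDFlow.Scaling.HubClassChainEigenbasis
import Summits.Ventures.LatticeQCDFlow.Scaling.HubChainTransitionLaw

/-!
HONEST FRAMING: exact (Metropolis-corrected) sampling algorithms for lattice gauge theory; figures
of merit are autocorrelation/cost numbers at stated couplings and volumes; no continuum-physics
claim.

# HubClassChainTransitionLaw — THE SWAP PHASE SOLVED EXACTLY, VIII: THE CLOSED `n`-STEP LAW OF THE LUMPED (CONTENT-CLASS) HUB CHAIN OF CHAPTER W,
# `Pⁿ(i,j) = N_jρ_j·(1/R_m + Σ_k β_kⁿ f_k(i)f_k(j)N_k/(ρ_kR_kR_{k+1}))`, AND ITS SMITH–TIERNEY FORM `Pⁿ(i,j) = N_jρ_j·T_n(max(i,j)) + β_iⁿδ_{ij}` WITH THE SAME `T_n` AS THE LABELLED CHAIN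
# (lean-2 GEN-39, ours)

Venture-side (OURS).  Cell `lqcd-flow` (pub-lqcd), unit `pub-lqcd-lean-2-g39`, 2026-08-30.  Chapter Y, file 8.  Setting of file 7 (`HubClassChainEigenbasis`): content classes ranked by
depth, weights `N > 0`, `P(i,j) = cN_j·min{1,ρ_j/ρ_i}` off the diagonal (chapter W's `Kh`), `R_k = Σ_{i<k}N_iρ_i`, `M_k = Σ_{i≥k}N_i`, `f_k`, `β_k` as there; `Pⁿ` by its recursion.

* `hubClass_rho_stationary` (`Σ_l N_lρ_lP(l,j) = N_jρ_j`), `hubClass_eigen_left`;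
* **`hubClass_pow_eq`**: `Pⁿ(i,j) = N_jρ_j·(1/R_m + Σ_{k<m} β_kⁿf_k(i)f_k(j)N_k/(ρ_kR_kR_{k+1}))`;
* `hubClass_mode_sum`, **`hubClass_pow_offdiag`** (`Pⁿ(i,j) = N_jρ_j·T_n(max(i,j))` for `i ≠ j`), **`hubClass_pow_diag`** (`Pⁿ(j,j) = N_jρ_jT_n(j) + β_jⁿ`),
  `T_n(j) = (1−β_jⁿ)/R_m + Σ_{j<k<m}(1/R_k − 1/R_{k+1})(β_kⁿ − β_jⁿ)` — the SAME function of the ranks as for the labelled chain (file 2), only `R`, `β` now carry the class weights.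

Reading (no numerics implied): the `j`-attempt hub-content laws `x_j` of chapter W's tagged chains are these `Pʲ(z,·)`; e.g. `x_j(c) = N_cρ_c·T_j(max(rank z, rank c))` for a content
`c ≠ z`.  Literature grade (cell rule): OWN, elementary; nothing cited; no new bib keys.
-/

open Finset

namespace Summit.Ventures.LatticeQCDFlow.Scaling

section HubClassPow
variable {m : ℕ} {ρ N R M β : ℕ → ℝ} {c : ℝ} {P f : ℕ → ℕ → ℝ} {Pn : ℕ → ℕ → ℕ → ℝ} {T : ℕ → ℕ → ℝ}

/-- **Stationarity of `π = Nρ`:** `Σ_{l<m} N_lρ_lP(l,j) = N_jρ_j` for `j < m`. [ours] -/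
theorem hubClass_rho_stationary (hρ : ∀ i, 0 < ρ i) (hPoff : ∀ i j, i ≠ j → P i j = c * N j * min 1 (ρ j / ρ i))
    (hPdiag : ∀ i, P i i = 1 - ∑ j ∈ (range m).erase i, P i j) {j : ℕ} (hj : j < m) : ∑ l ∈ range m, N l * ρ l * P l j = N j * ρ j := by
  calc ∑ l ∈ range m, N l * ρ l * P l j = ∑ l ∈ range m, N j * ρ j * P j l := sum_congr rfl fun l _ => hubClass_reversible hρ hPoff l j
    _ = N j * ρ j := by rw [← mul_sum, hubChain_rowsum hPdiag hj, mul_one]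

/-- **Left eigen-equation:** `Σ_{l<m} N_lρ_lf_k(l)P(l,j) = β_k·N_jρ_j·f_k(j)`. [ours] -/
theorem hubClass_eigen_left (hρ : ∀ i, 0 < ρ i) (hmono : Monotone ρ) (hN : ∀ i, 0 < N i) (hR : ∀ k, R k = ∑ i ∈ range k, N i * ρ i)
    (hM : ∀ k, M k = ∑ i ∈ Ico k m, N i)
    (hPoff : ∀ i j, i ≠ j → P i j = c * N j * min 1 (ρ j / ρ i)) (hPdiag : ∀ i, P i i = 1 - ∑ j ∈ (range m).erase i, P i j)
    (hf : ∀ k i, f k i = if i < k then ρ k else if i = k then -(R k / N k) else 0)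
    (hβ : ∀ k, β k = 1 - c * (M k + R k / ρ k)) {k j : ℕ} (hk : k < m) (hj : j < m) :
    ∑ l ∈ range m, N l * ρ l * f k l * P l j = β k * (N j * ρ j) * f k j := by
  calc ∑ l ∈ range m, N l * ρ l * f k l * P l j = ∑ l ∈ range m, N j * ρ j * (P j l * f k l) := sum_congr rfl fun l _ => by
          rw [mul_right_comm, hubClass_reversible hρ hPoff l j]; ring
    _ = β k * (N j * ρ j) * f k j := by rw [← mul_sum, hubClass_eigen hρ hmono hN hR hM hPoff hPdiag hf hβ hk hj]; ring

/-- **THE CLOSED `n`-STEP LAW (class weights):** `Pⁿ(i,j) = N_jρ_j·(1/R_m + Σ_{k<m} β_kⁿf_k(i)f_k(j)N_k/(ρ_kR_kR_{k+1}))` for `i, j < m`. [ours] -/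
theorem hubClass_pow_eq (hρ : ∀ i, 0 < ρ i) (hmono : Monotone ρ) (hN : ∀ i, 0 < N i) (hR : ∀ k, R k = ∑ i ∈ range k, N i * ρ i)
    (hM : ∀ k, M k = ∑ i ∈ Ico k m, N i)
    (hPoff : ∀ i j, i ≠ j → P i j = c * N j * min 1 (ρ j / ρ i)) (hPdiag : ∀ i, P i i = 1 - ∑ j ∈ (range m).erase i, P i j)
    (hf : ∀ k i, f k i = if i < k then ρ k else if i = k then -(R k / N k) else 0)
    (hβ : ∀ k, β k = 1 - c * (M k + R k / ρ k))
    (hP0 : ∀ i j, Pn 0 i j = if i = j then 1 else 0) (hPs : ∀ n i j, Pn (n + 1) i j = ∑ l ∈ range m, Pn n i l * P l j)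
    (n : ℕ) {i j : ℕ} (hi : i < m) (hj : j < m) :
    Pn n i j = N j * ρ j * (1 / R m + ∑ k ∈ range m, β k ^ n * (f k i * f k j * N k) / (ρ k * R k * R (k + 1))) := by
  induction n generalizing j with
  | zero =>
      rw [hP0, ← hubClass_complete hρ hN hR hf hi hj]
      congr 1; congr 1
      exact sum_congr rfl fun k _ => by rw [pow_zero, one_mul]
  | succ n ih =>
      rw [hPs]
      calc ∑ l ∈ range m, Pn n i l * P l j
          = ∑ l ∈ range m, ((1 / R m) * (N l * ρ l * P l j) + ∑ k ∈ range m, (β k ^ n * (f k i * N k) / (ρ k * R k * R (k + 1))) * (N l * ρ l * f k l * P l j)) := by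
            refine sum_congr rfl fun l hl => ?_
            rw [ih (mem_range.mp hl), mul_add, add_mul, mul_sum, sum_mul]
            congr 1
            · ring
            · exact sum_congr rfl fun k _ => by ring
        _ = (1 / R m) * (N j * ρ j) + ∑ k ∈ range m, (β k ^ n * (f k i * N k) / (ρ k * R k * R (k + 1))) * (β k * (N j * ρ j) * f k j) := by
            rw [sum_add_distrib, ← mul_sum, hubClass_rho_stationary hρ hPoff hPdiag hj, sum_comm]
            congr 1
            exact sum_congr rfl fun k hk => by rw [← mul_sum, hubClass_eigen_left hρ hmono hN hR hM hPoff hPdiag hf hβ (mem_range.mp hk) hj]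
        _ = N j * ρ j * (1 / R m + ∑ k ∈ range m, β k ^ (n + 1) * (f k i * f k j * N k) / (ρ k * R k * R (k + 1))) := by
            rw [mul_add, mul_sum]
            congr 1
            · ring
            · exact sum_congr rfl fun k _ => by rw [pow_succ]; ring

/-- The mode sum split at the deeper rank `j ≥ i` (class weights, arbitrary mode coefficients `a_k`). [ours] -/
theorem hubClass_mode_sum (hρ : ∀ i, 0 < ρ i) (hN : ∀ i, 0 < N i) (hR : ∀ k, R k = ∑ i ∈ range k, N i * ρ i)
    (hf : ∀ k i, f k i = if i < k then ρ k else if i = k then -(R k / N k) else 0) (a : ℕ → ℝ) {i j : ℕ} (hij : i ≤ j) (hj : j < m) :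
    ∑ k ∈ range m, a k * (f k i * f k j * N k) / (ρ k * R k * R (k + 1))
      = a j * (f j i * f j j * N j) / (ρ j * R j * R (j + 1)) + ∑ k ∈ Ico (j + 1) m, a k * (1 / R k - 1 / R (k + 1)) := by
  rw [hubChain_split3 hj]
  have h0 : ∑ k ∈ range j, a k * (f k i * f k j * N k) / (ρ k * R k * R (k + 1)) = 0 := by
    refine sum_eq_zero fun k hk => ?_
    have : k < j := mem_range.mp hk
    rw [hf k j, if_neg (by omega), if_neg (by omega)]; simp
  rw [h0, zero_add]
  congr 1
  refine sum_congr rfl fun k hk => ?_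
  have hk1 : j + 1 ≤ k := (mem_Ico.mp hk).1
  have hRk : 0 < R k := by rw [hR k]; exact sum_pos (fun i _ => mul_pos (hN i) (hρ i)) ⟨0, mem_range.mpr (by omega)⟩
  have hRk1 : R (k + 1) = R k + N k * ρ k := by rw [hR (k + 1), sum_range_succ, ← hR k]
  rw [hf k i, if_pos (by omega), hf k j, if_pos (by omega), hRk1]
  have hρk := hρ k; have hNk := hN k
  field_simp
  ring

/-- **THE SMITH–TIERNEY FORM, off the diagonal (class weights):** for `i ≠ j` (ranks `< m`), `Pⁿ(i,j) = N_jρ_j·T_n(max(i,j))`, `T_n` as in file 2. [ours] -/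
theorem hubClass_pow_offdiag (hρ : ∀ i, 0 < ρ i) (hmono : Monotone ρ) (hN : ∀ i, 0 < N i) (hR : ∀ k, R k = ∑ i ∈ range k, N i * ρ i)
    (hM : ∀ k, M k = ∑ i ∈ Ico k m, N i)
    (hPoff : ∀ i j, i ≠ j → P i j = c * N j * min 1 (ρ j / ρ i)) (hPdiag : ∀ i, P i i = 1 - ∑ j ∈ (range m).erase i, P i j)
    (hf : ∀ k i, f k i = if i < k then ρ k else if i = k then -(R k / N k) else 0)
    (hβ : ∀ k, β k = 1 - c * (M k + R k / ρ k))
    (hP0 : ∀ i j, Pn 0 i j = if i = j then 1 else 0) (hPs : ∀ n i j, Pn (n + 1) i j = ∑ l ∈ range m, Pn n i l * P l j)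
    (hT : ∀ n j, T n j = (1 - β j ^ n) / R m + ∑ k ∈ Ico (j + 1) m, (1 / R k - 1 / R (k + 1)) * (β k ^ n - β j ^ n))
    (n : ℕ) {i j : ℕ} (hi : i < m) (hj : j < m) (hij : i ≠ j) :
    Pn n i j = N j * ρ j * T n (max i j) := by
  have hTexp : ∀ jj, jj < m → T n jj = 1 / R m - β jj ^ n / R (jj + 1) + ∑ k ∈ Ico (jj + 1) m, β k ^ n * (1 / R k - 1 / R (k + 1)) := by
    intro jj hjj
    rw [hT]
    have e : ∑ k ∈ Ico (jj + 1) m, (1 / R k - 1 / R (k + 1)) * (β k ^ n - β jj ^ n)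
        = ∑ k ∈ Ico (jj + 1) m, β k ^ n * (1 / R k - 1 / R (k + 1)) - β jj ^ n * ∑ k ∈ Ico (jj + 1) m, (1 / R k - 1 / R (k + 1)) := by
      rw [mul_sum, ← sum_sub_distrib]; exact sum_congr rfl fun k _ => by ring
    rw [e, hubChain_telescope hjj]
    ring
  rcases Nat.lt_or_gt_of_ne hij with hlt | hgt
  · rw [max_eq_right hlt.le, hubClass_pow_eq hρ hmono hN hR hM hPoff hPdiag hf hβ hP0 hPs n hi hj, hubClass_mode_sum hρ hN hR hf (fun k => β k ^ n) hlt.le hj, hTexp j hj]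
    have hRj1 : R (j + 1) = R j + N j * ρ j := by rw [hR (j + 1), sum_range_succ, ← hR j]
    have hRj : 0 < R j := by rw [hR j]; exact sum_pos (fun i _ => mul_pos (hN i) (hρ i)) ⟨i, mem_range.mpr hlt⟩
    rw [hf j i, if_pos hlt, hf j j, if_neg (lt_irrefl j), if_pos rfl, hRj1]
    have hρj := hρ j; have hNj := hN j
    field_simp
    ring
  · rw [max_eq_left hgt.le, hubClass_pow_eq hρ hmono hN hR hM hPoff hPdiag hf hβ hP0 hPs n hi hj]
    rw [show (∑ k ∈ range m, β k ^ n * (f k i * f k j * N k) / (ρ k * R k * R (k + 1))) = ∑ k ∈ range m, β k ^ n * (f k j * f k i * N k) / (ρ k * R k * R (k + 1)) from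
      sum_congr rfl fun k _ => by rw [mul_comm (f k i)]]
    rw [hubClass_mode_sum hρ hN hR hf (fun k => β k ^ n) hgt.le hi, hTexp i hi]
    have hRi1 : R (i + 1) = R i + N i * ρ i := by rw [hR (i + 1), sum_range_succ, ← hR i]
    have hRi : 0 < R i := by rw [hR i]; exact sum_pos (fun i _ => mul_pos (hN i) (hρ i)) ⟨j, mem_range.mpr hgt⟩
    rw [hf i j, if_pos hgt, hf i i, if_neg (lt_irrefl i), if_pos rfl, hRi1]
    have hρi := hρ i; have hNi := hN i
    field_simp
    ring

/-- **THE SMITH–TIERNEY FORM, on the diagonal (class weights):** `Pⁿ(j,j) = N_jρ_j·T_n(j) + β_jⁿ`. [ours] -/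
theorem hubClass_pow_diag (hρ : ∀ i, 0 < ρ i) (hmono : Monotone ρ) (hN : ∀ i, 0 < N i) (hR : ∀ k, R k = ∑ i ∈ range k, N i * ρ i)
    (hM : ∀ k, M k = ∑ i ∈ Ico k m, N i)
    (hPoff : ∀ i j, i ≠ j → P i j = c * N j * min 1 (ρ j / ρ i)) (hPdiag : ∀ i, P i i = 1 - ∑ j ∈ (range m).erase i, P i j)
    (hf : ∀ k i, f k i = if i < k then ρ k else if i = k then -(R k / N k) else 0)
    (hβ : ∀ k, β k = 1 - c * (M k + R k / ρ k))
    (hP0 : ∀ i j, Pn 0 i j = if i = j then 1 else 0) (hPs : ∀ n i j, Pn (n + 1) i j = ∑ l ∈ range m, Pn n i l * P l j)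
    (hT : ∀ n j, T n j = (1 - β j ^ n) / R m + ∑ k ∈ Ico (j + 1) m, (1 / R k - 1 / R (k + 1)) * (β k ^ n - β j ^ n))
    (n : ℕ) {j : ℕ} (hj : j < m) : Pn n j j = N j * ρ j * T n j + β j ^ n := by
  rw [hubClass_pow_eq hρ hmono hN hR hM hPoff hPdiag hf hβ hP0 hPs n hj hj, hubClass_mode_sum hρ hN hR hf (fun k => β k ^ n) le_rfl hj, hT]
  have e : ∑ k ∈ Ico (j + 1) m, (1 / R k - 1 / R (k + 1)) * (β k ^ n - β j ^ n)
      = ∑ k ∈ Ico (j + 1) m, β k ^ n * (1 / R k - 1 / R (k + 1)) - β j ^ n * ∑ k ∈ Ico (j + 1) m, (1 / R k - 1 / R (k + 1)) := by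
    rw [mul_sum, ← sum_sub_distrib]; exact sum_congr rfl fun k _ => by ring
  rw [e, hubChain_telescope hj]
  have hRj1 : R (j + 1) = R j + N j * ρ j := by rw [hR (j + 1), sum_range_succ, ← hR j]
  have hR0 : 0 ≤ R j := by rw [hR j]; exact sum_nonneg fun i _ => mul_nonneg (hN i).le (hρ i).le
  have hρj := hρ j; have hNj := hN j
  have hRj1pos : 0 < R (j + 1) := by rw [hRj1]; nlinarith
  rw [hf j j, if_neg (lt_irrefl j), if_pos rfl, hRj1]
  by_cases hRj : R j = 0
  · rw [hRj]; simp; field_simp; ring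
  · field_simp
    ring

end HubClassPow

end Summit.Ventures.LatticeQCDFlow.Scaling
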